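import Summits.Ventures.PercRepro.Concavity5
import Summits.Ventures.PercRepro.CrossTermPlus

/-!
# PercRepro — Lemma 6 (per-mark 5a block), the type identity, and the chain to C-011 (typer-2, gen 3)

`proofs/LEAD-C011-concavity.md` §10.4 (lead g3, 04:47Z; ASSIGNMENTS v14):

* **`Lemma6Gen`** (per mark `q`, edge `g = (a, v)`): `P(B_q)·[P(C^v_{q′}) + P(C^v_{q″}) + P(B_{q′})
  + P(B_{q″})] ≤ P(A_q)·P(E^v)`; `Concavity5a_of_Lemma6Gen`: summed over `q` it gives MORE than
  the 5a block, so `Lemma6Gen ∧ Concavity5b ⇒ Concavity5Mark` (`Concavity5Mark_of_Lemma6Gen_5b`);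
* `sixMarkLHS`, `sixMarkRHS` — the two sides of the 6-mark form §3, for any edge;
  **`TypeIdentity`** — the one unformalised sentence of the dossier, as a named Prop:
  `Q⁺(Δ_g, Δ_g) = sixMarkLHS − sixMarkRHS` for every edge (§1–§2; verified numerically 400/400);
* with it: `EdgeQuadNonpos_of_Concavity6Mark` (`TypeIdentity → Concavity6Mark → EdgeQuadNonpos`),
  the SURE versions `Concavity5MarkSure`, `Lemma6GenSure`, `Concavity5bSure` (hypothesis: a free
  edge with an endpoint sure-connected to a mark, the reading of «every minor»), and
  `concaveOn_of_Lemma6GenSure_5bSure` (`TypeIdentity → Lemma6GenSure → Concavity5bSure →`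
  concavity along `g` for the marks `(a, b, c, d)` with `G.fst g` sure-connected to `a`) and
  `C011_of_Concavity5MarkSure` (`TypeIdentity → Concavity5MarkSure → C011`) — the chain of the
  dossier in the kernel with `TypeIdentity` as its named gap; the step from the oriented,
  first-mark statements to `Concavity5MarkSure` needs the relabelling invariance of the 6-mark
  form (not formalised);
* **`Lemma6Pendant`** (the 4-mark pendant form on `H = G − a`, p1's Lean target) and
  **`PendantFiveA`** (the pendant (5a)), with `PendantFiveA_of_Lemma6Pendant`.
-/

namespace PercRepro

open Finset

namespace MultiGraph

variable {V E : Type*} (G : MultiGraph V E) [Fintype E] [DecidableEq E]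

/-- The left side of the 6-mark form §3: `½ Σ_{i≠j} P(Bᵢ)P(Bⱼ) + Σ_{i≠j} P(Bᵢ)P(Cⱼ)`. -/
noncomputable def sixMarkLHS (p : E → ℝ) (g : E) (a b c d : V) : ℝ :=
  (1 / 2 : ℝ) * (∑ i : Fin 3, ∑ j : Fin 3, if i ≠ j then
      prob p (G.typeB g a b c d i) * prob p (G.typeB g a b c d j) else 0) +
    (∑ i : Fin 3, ∑ j : Fin 3, if i ≠ j then
      prob p (G.typeB g a b c d i) * prob p (G.typeC g a b c d j) else 0)

/-- The right side of the 6-mark form §3: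
`Σ_{i≠j} P(Aᵢ)P(Bⱼ) + Σᵢ P(Aᵢ)P(Dᵢ) + P(A)P(E) + Σ_{i≠j} P(Cᵢ)P(Dⱼ) + ½ Σ_{i≠j} P(Dᵢ)P(Dⱼ)`. -/
noncomputable def sixMarkRHS (p : E → ℝ) (g : E) (a b c d : V) : ℝ :=
  (∑ i : Fin 3, ∑ j : Fin 3, if i ≠ j then
      prob p (G.typeA g a b c d i) * prob p (G.typeB g a b c d j) else 0) +
    (∑ i : Fin 3, prob p (G.typeA g a b c d i) * prob p (G.typeD g a b c d i)) +
    (∑ i : Fin 3, prob p (G.typeA g a b c d i)) * prob p (G.typeE g a b c d) +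
    (∑ i : Fin 3, ∑ j : Fin 3, if i ≠ j then
      prob p (G.typeC g a b c d i) * prob p (G.typeD g a b c d j) else 0) +
    (1 / 2 : ℝ) * (∑ i : Fin 3, ∑ j : Fin 3, if i ≠ j then
      prob p (G.typeD g a b c d i) * prob p (G.typeD g a b c d j) else 0)

end MultiGraph

/-- `Concavity6Mark` is `sixMarkLHS ≤ sixMarkRHS` for every edge. -/
theorem concavity6Mark_iff : Concavity6Mark ↔
    ∀ {V E : Type} [Fintype E] [DecidableEq E] (G : MultiGraph V E) (p : E → ℝ), IsProb p →
      ∀ (a b c d : V) (g : E), G.sixMarkLHS p g a b c d ≤ G.sixMarkRHS p g a b c d :=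
  Iff.rfl

/-- **The type identity** (`LEAD-C011-concavity.md` §1–§2, the sentence of the dossier that is not
formalised here; numerically exact on 400/400 random instances): for every edge `g`, the
`t²`-coefficient of `Φ⁺` along `g` is the 6-mark form,
`Q⁺(Δ_g, Δ_g) = sixMarkLHS − sixMarkRHS`. -/
def TypeIdentity : Prop :=
  ∀ {V E : Type} [Fintype E] [DecidableEq E] (G : MultiGraph V E) (p : E → ℝ), IsProb p →
    ∀ (a b c d : V) (g : E),
      G.deltaQuad p g a b c d = G.sixMarkLHS p g a b c d - G.sixMarkRHS p g a b c d

/-- With the type identity, the 6-mark form for every edge is the concavity lemma. -/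
theorem EdgeQuadNonpos_of_Concavity6Mark (hid : TypeIdentity) (h6 : Concavity6Mark) :
    EdgeQuadNonpos := by
  intro V E _ _ G p hp a b c d g
  rw [hid G p hp a b c d g]
  have := h6 G p hp a b c d g
  change G.sixMarkLHS p g a b c d ≤ G.sixMarkRHS p g a b c d at this
  linarith

/-- With the type identity, the 6-mark form for every edge gives C-005⁺. -/
theorem C011_of_Concavity6Mark (hid : TypeIdentity) (h6 : Concavity6Mark) : C011 :=
  C011_of_EdgeQuadNonpos (EdgeQuadNonpos_of_Concavity6Mark hid h6)

/-! ### Lemma 6: the 5a block per mark -/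

/-- **Lemma 6** (§10.4 (B)), edge oriented `G.fst g = a`, marks distinct: for every `q` (indexed
by the crossing cell `i` pairing `a` with `q`),
`P(B_q)·[P(C^v_{q′}) + P(C^v_{q″}) + P(B_{q′}) + P(B_{q″})] ≤ P(A_q)·P(E^v)`. -/
def Lemma6Gen : Prop :=
  ∀ {V E : Type} [Fintype E] [DecidableEq E] (G : MultiGraph V E) (p : E → ℝ), IsProb p →
    ∀ (a b c d : V), [a, b, c, d].Nodup → ∀ g : E, G.fst g = a → ∀ i : Fin 3,
      prob p (G.typeB g a b c d i) *
          (∑ j : Fin 3, if i ≠ j then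
            prob p (G.typeCv g a b c d j) + prob p (G.typeB g a b c d j) else 0) ≤
        prob p (G.typeA g a b c d i) * prob p (G.typeEv g a b c d)

/-- **Lemma 6 summed over the marks gives the 5a block** (the `B × B` terms are counted twice and
the `A_q B_{q′}` terms of 5a are idle): `Lemma6Gen → Concavity5a`. -/
theorem Concavity5a_of_Lemma6Gen (h : Lemma6Gen) : Concavity5a := by
  intro V E _ _ G p hp a b c d hn g hg
  have h0 := h G p hp a b c d hn g hg 0
  have h1 := h G p hp a b c d hn g hg 1
  have h2 := h G p hp a b c d hn g hg 2
  have hAB : ∀ i j : Fin 3, 0 ≤ prob p (G.typeA g a b c d i) * prob p (G.typeB g a b c d j) :=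
    fun i j => mul_nonneg (prob_nonneg hp _) (prob_nonneg hp _)
  have hBB : ∀ i j : Fin 3, 0 ≤ prob p (G.typeB g a b c d i) * prob p (G.typeB g a b c d j) :=
    fun i j => mul_nonneg (prob_nonneg hp _) (prob_nonneg hp _)
  simp only [Fin.sum_univ_three] at h0 h1 h2 ⊢
  simp only [ne_eq, Fin.reduceEq, not_false_eq_true, if_true, if_false, not_true_eq_false,
    zero_add, add_zero] at h0 h1 h2 ⊢
  nlinarith [h0, h1, h2, hAB 0 1, hAB 0 2, hAB 1 0, hAB 1 2, hAB 2 0, hAB 2 1,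
    hBB 0 1, hBB 0 2, hBB 1 0, hBB 1 2, hBB 2 0, hBB 2 1]

/-- `Lemma6Gen ∧ Concavity5b ⇒ Concavity5Mark` (Lemma 5 for the mark-incident edges). -/
theorem Concavity5Mark_of_Lemma6Gen_5b (h6 : Lemma6Gen) (hb : Concavity5b) : Concavity5Mark :=
  Concavity5Mark_of_5a_5b (Concavity5a_of_Lemma6Gen h6) hb

/-! ### The SURE versions: «every minor» read in the free-edge setting -/

/-- **Lemma 5 on every minor**: the 6-mark form for every FREE edge `g` one of whose endpoints is
joined by sure edges to one of four distinct marks (`C011Induction.lean` reading of «mark-incident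
edge of a minor»). -/
def Concavity5MarkSure : Prop :=
  ∀ {V E : Type} [Fintype E] [DecidableEq E] (G : MultiGraph V E) (p : E → ℝ), IsProb p →
    ∀ (a b c d : V), [a, b, c, d].Nodup → ∀ g : E, IsFree p g →
      (∃ m, (m = a ∨ m = b ∨ m = c ∨ m = d) ∧
        (G.SureConn p (G.fst g) m ∨ G.SureConn p (G.snd g) m)) →
      G.sixMarkLHS p g a b c d ≤ G.sixMarkRHS p g a b c d

/-- With the type identity, Lemma 5 on every minor is the free-edge concavity lemma. -/
theorem Concavity5Sure_of_Concavity5MarkSure (hid : TypeIdentity) (h : Concavity5MarkSure) :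
    Concavity5Sure := by
  intro V E _ _ G p hp a b c d hn g hg hm
  rw [G.concaveOn_phiPlus_iff, hid G p hp a b c d g]
  have := h G p hp a b c d hn g hg hm
  linarith

/-- With the type identity, Lemma 5 on every minor gives C-005⁺. -/
theorem C011_of_Concavity5MarkSure (hid : TypeIdentity) (h : Concavity5MarkSure) : C011 :=
  C011_of_Concavity5Sure (Concavity5Sure_of_Concavity5MarkSure hid h)

/-- **Lemma 6 on every minor**, oriented: the endpoint `u = G.fst g` is sure-connected to the mark
`a` (the other endpoint is `v`); `q` ranges over the crossing cells pairing `a`. -/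
def Lemma6GenSure : Prop :=
  ∀ {V E : Type} [Fintype E] [DecidableEq E] (G : MultiGraph V E) (p : E → ℝ), IsProb p →
    ∀ (a b c d : V), [a, b, c, d].Nodup → ∀ g : E, IsFree p g → G.SureConn p (G.fst g) a →
      ∀ i : Fin 3,
        prob p (G.typeB g a b c d i) *
            (∑ j : Fin 3, if i ≠ j then
              prob p (G.typeCv g a b c d j) + prob p (G.typeB g a b c d j) else 0) ≤
          prob p (G.typeA g a b c d i) * prob p (G.typeEv g a b c d)

/-- **Lemma 5b on every minor**, oriented as `Lemma6GenSure`. -/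
def Concavity5bSure : Prop :=
  ∀ {V E : Type} [Fintype E] [DecidableEq E] (G : MultiGraph V E) (p : E → ℝ), IsProb p →
    ∀ (a b c d : V), [a, b, c, d].Nodup → ∀ g : E, IsFree p g → G.SureConn p (G.fst g) a →
      (∑ i : Fin 3, ∑ j : Fin 3, if i ≠ j then
          prob p (G.typeB g a b c d i) * prob p (G.typeCa g a b c d j) else 0) ≤
      (∑ i : Fin 3, prob p (G.typeA g a b c d i) * prob p (G.typeD g a b c d i)) +
        (∑ i : Fin 3, prob p (G.typeA g a b c d i)) * prob p (G.typeEa g a b c d) +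
        (∑ i : Fin 3, ∑ j : Fin 3, if i ≠ j then
          prob p (G.typeCv g a b c d i) * prob p (G.typeD g a b c d j) else 0) +
        (∑ i : Fin 3, ∑ j : Fin 3, if i ≠ j then
          prob p (G.typeCa g a b c d i) * prob p (G.typeD g a b c d j) else 0) +
        (1 / 2 : ℝ) * (∑ i : Fin 3, ∑ j : Fin 3, if i ≠ j then
          prob p (G.typeD g a b c d i) * prob p (G.typeD g a b c d j) else 0)

namespace MultiGraph

variable {V E : Type*} (G : MultiGraph V E) [DecidableEq E]

/-- Sure-connectivity does not see the orientation of an edge. -/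
theorem flipEdge_sureConn (p : E → ℝ) (g : E) (x y : V) :
    (G.flipEdge g).SureConn p x y ↔ G.SureConn p x y :=
  G.flipEdge_conn g _ x y

/-- The left side of §3 is flip-invariant. -/
theorem sixMarkLHS_flipEdge [Fintype E] (p : E → ℝ) (g : E) (a b c d : V) :
    (G.flipEdge g).sixMarkLHS p g a b c d = G.sixMarkLHS p g a b c d := by
  simp only [sixMarkLHS, flipEdge_typeB, flipEdge_typeC]

/-- The right side of §3 is flip-invariant. -/
theorem sixMarkRHS_flipEdge [Fintype E] (p : E → ℝ) (g : E) (a b c d : V) :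
    (G.flipEdge g).sixMarkRHS p g a b c d = G.sixMarkRHS p g a b c d := by
  simp only [sixMarkRHS, flipEdge_typeA, flipEdge_typeB, flipEdge_typeC, flipEdge_typeD,
    flipEdge_typeE]

end MultiGraph

/-- The oriented 6-mark inequality from Lemma 6 and 5b on a minor, for the orientation
`u` sure-connected to the mark `a` (the algebra of `Concavity5a_of_Lemma6Gen` and
`concavity5_of_5a_5b_fst`, verbatim). -/
theorem sixMark_of_Lemma6GenSure_5bSure (h6 : Lemma6GenSure) (hb : Concavity5bSure)
    {V E : Type} [Fintype E] [DecidableEq E] (G : MultiGraph V E) (p : E → ℝ) (hp : IsProb p)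
    (a b c d : V) (hn : [a, b, c, d].Nodup) (g : E) (hg : IsFree p g)
    (hu : G.SureConn p (G.fst g) a) :
    G.sixMarkLHS p g a b c d ≤ G.sixMarkRHS p g a b c d := by
  have h0 := h6 G p hp a b c d hn g hg hu 0
  have h1 := h6 G p hp a b c d hn g hg hu 1
  have h2 := h6 G p hp a b c d hn g hg hu 2
  have h5b := hb G p hp a b c d hn g hg hu
  have hAB : ∀ i j : Fin 3, 0 ≤ prob p (G.typeA g a b c d i) * prob p (G.typeB g a b c d j) :=
    fun i j => mul_nonneg (prob_nonneg hp _) (prob_nonneg hp _)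
  have hBB : ∀ i j : Fin 3, 0 ≤ prob p (G.typeB g a b c d i) * prob p (G.typeB g a b c d j) :=
    fun i j => mul_nonneg (prob_nonneg hp _) (prob_nonneg hp _)
  have hC : ∀ i, prob p (G.typeC g a b c d i) =
      prob p (G.typeCa g a b c d i) + prob p (G.typeCv g a b c d i) := fun i => by
    rw [G.typeC_eq_union, prob_union_of_disjoint p (G.disjoint_typeCa_typeCv g a b c d i)]
  have hE : prob p (G.typeE g a b c d) =
      prob p (G.typeEa g a b c d) + prob p (G.typeEv g a b c d) := by
    rw [G.typeE_eq_union, prob_union_of_disjoint p (G.disjoint_typeEa_typeEv g a b c d)]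
  simp only [MultiGraph.sixMarkLHS, MultiGraph.sixMarkRHS, Fin.sum_univ_three, hC, hE] at h5b ⊢
  simp only [Fin.sum_univ_three] at h0 h1 h2
  simp only [ne_eq, Fin.reduceEq, not_false_eq_true, if_true, if_false, not_true_eq_false,
    zero_add, add_zero] at h0 h1 h2 h5b ⊢
  nlinarith [h0, h1, h2, h5b, hAB 0 1, hAB 0 2, hAB 1 0, hAB 1 2, hAB 2 0, hAB 2 1,
    hBB 0 1, hBB 0 2, hBB 1 0, hBB 1 2, hBB 2 0, hBB 2 1]

/-- For the marks `(a, b, c, d)` with `u = G.fst g` sure-connected to `a`: with the type identity,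
Lemma 6 and 5b on the minor give concavity along `g`. The general `Concavity5Sure` (any of the
four marks, either endpoint) needs in addition the relabelling invariance of the 6-mark form under
permutations of the marks (not formalised: the types are defined relative to the first mark). -/
theorem concaveOn_of_Lemma6GenSure_5bSure (hid : TypeIdentity) (h6 : Lemma6GenSure)
    (hb : Concavity5bSure) {V E : Type} [Fintype E] [DecidableEq E] (G : MultiGraph V E)
    (p : E → ℝ) (hp : IsProb p) (a b c d : V) (hn : [a, b, c, d].Nodup) (g : E)
    (hg : IsFree p g) (hu : G.SureConn p (G.fst g) a) :
    ConcaveOn ℝ (Set.Icc (0 : ℝ) 1) fun t => G.PhiPlus (Function.update p g t) a b c d := by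
  rw [G.concaveOn_phiPlus_iff, hid G p hp a b c d g]
  have := sixMark_of_Lemma6GenSure_5bSure h6 hb G p hp a b c d hn g hg hu
  linarith

/-! ### Lemma 6 in PENDANT form (the 4-mark statement on `H = G − a`, `v` distinguished) -/

/-- **Lemma 6, pendant form** (`LEAD-C011-concavity.md` §10.4 (B); p1 04:52:36Z: a THEOREM by Harris
after revealing the `v`-cluster): for four distinct marks `v, b, c, d` (the rows of
`G.law4 p v b c d`, `v` the endpoint of the pendant edge), for each of the three crossing cells
`x_i = P(vi|jk)` pairing `v` with `i`, with `R_i = P(vi|j|k)` and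
`Y_i = P(vij|k) + P(vik|j) + P(vj|ik) + P(vk|ij)` (the four cells above `x_i` and `R_i` other than
`⊤`): `x_i · Y_i ≤ R_i · P(vbcd)`. Rows (order `rgs4` of `![v, b, c, d]`): `i = b`:
`x = 3 (vb|cd)`, `R = 4 (vb|c|d)`, `Y = 1 (vbc|d), 2 (vbd|c), 6 (vc|bd), 8 (vd|bc)`; `i = c`:
`x = 6`, `R = 7 (vc|b|d)`, `Y = 1, 5 (vcd|b), 3, 8`; `i = d`: `x = 8`, `R = 11 (vd|b|c)`,
`Y = 2, 5, 3, 6`. -/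
def Lemma6Pendant : Prop :=
  ∀ {V E : Type} [Fintype E] [DecidableEq E] (G : MultiGraph V E) (p : E → ℝ), IsProb p →
    ∀ (v b c d : V), [v, b, c, d].Nodup →
      G.law4 p v b c d 3 * (G.law4 p v b c d 1 + G.law4 p v b c d 2 + G.law4 p v b c d 6 +
          G.law4 p v b c d 8) ≤ G.law4 p v b c d 4 * G.law4 p v b c d 0 ∧
      G.law4 p v b c d 6 * (G.law4 p v b c d 1 + G.law4 p v b c d 5 + G.law4 p v b c d 3 +
          G.law4 p v b c d 8) ≤ G.law4 p v b c d 7 * G.law4 p v b c d 0 ∧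
      G.law4 p v b c d 8 * (G.law4 p v b c d 2 + G.law4 p v b c d 5 + G.law4 p v b c d 3 +
          G.law4 p v b c d 6) ≤ G.law4 p v b c d 11 * G.law4 p v b c d 0

/-- **The pendant (5a)** (`LEAD-C011-concavity.md` §10, the 4-mark inequality on `H`):
`e₂(x) + Σ_{i≠j} x_i W_j ≤ Σ_{i≠j} R_i x_j + R · P(vbcd)`, `W_j = P(vik|j)` (the 3|1 cell with `j`
alone), `R = R_b + R_c + R_d`; rows as in `Lemma6Pendant` (`W_b = 5 (vcd|b)`, `W_c = 2 (vbd|c)`,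
`W_d = 1 (vbc|d)`). -/
def PendantFiveA : Prop :=
  ∀ {V E : Type} [Fintype E] [DecidableEq E] (G : MultiGraph V E) (p : E → ℝ), IsProb p →
    ∀ (v b c d : V), [v, b, c, d].Nodup →
      (G.law4 p v b c d 3 * G.law4 p v b c d 6 + G.law4 p v b c d 3 * G.law4 p v b c d 8 +
          G.law4 p v b c d 6 * G.law4 p v b c d 8) +
        (G.law4 p v b c d 3 * (G.law4 p v b c d 2 + G.law4 p v b c d 1) +
          G.law4 p v b c d 6 * (G.law4 p v b c d 5 + G.law4 p v b c d 1) +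
          G.law4 p v b c d 8 * (G.law4 p v b c d 5 + G.law4 p v b c d 2)) ≤
      (G.law4 p v b c d 4 * (G.law4 p v b c d 6 + G.law4 p v b c d 8) +
          G.law4 p v b c d 7 * (G.law4 p v b c d 3 + G.law4 p v b c d 8) +
          G.law4 p v b c d 11 * (G.law4 p v b c d 3 + G.law4 p v b c d 6)) +
        (G.law4 p v b c d 4 + G.law4 p v b c d 7 + G.law4 p v b c d 11) * G.law4 p v b c d 0

/-- **Pendant Lemma 6 summed over `i` dominates the pendant (5a)** (§10.4 (B): `Σ_i` gives
`Σ x_i W_j + 2e₂(x) ≤ R·top`, and the `R_i x_j` terms are idle). -/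
theorem PendantFiveA_of_Lemma6Pendant (h : Lemma6Pendant) : PendantFiveA := by
  intro V E _ _ G p hp v b c d hn
  obtain ⟨h1, h2, h3⟩ := h G p hp v b c d hn
  have hx : ∀ s t : Fin 15, 0 ≤ G.law4 p v b c d s * G.law4 p v b c d t :=
    fun s t => mul_nonneg (prob_nonneg hp _) (prob_nonneg hp _)
  nlinarith [h1, h2, h3, hx 4 6, hx 4 8, hx 7 3, hx 7 8, hx 11 3, hx 11 6, hx 3 6, hx 3 8, hx 6 8]

end PercRepro
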